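import Mathlib
import Summits.QuantumFields.BalabanUV.Beta.FP.TorusHeatSemigroup
import Summits.QuantumFields.BalabanUV.T4Continuum.Support.SliceFlatFreeKernel
import Literature.MathematicalPhysics.QuantumFieldTheory.Balaban1983to89.B5Action121

/-!
# `BalabanUV.Beta.FP.FreeBiResolventKernel` — road «FP» (binder row D1), lane IR-5′, FILE B-b1 of the `hAB` plan: on the CUBIC torus
# `T = Tor (fun _ ↦ Λ) = (ℤ∕Λ)^D` the FREE massive bi-resolvent `F₁² = (Δ + 1)⁻¹·(Δ + 1)⁻¹` of b05's scalar Laplacian `Δ = LapS (fun _ ↦ Λ) (n : ℂ)`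
# (lattice factor `n`; for the road `Λ = n·M₀`, `fine n (fun _ ↦ M₀) = fun _ ↦ n·M₀` by `rfl`) is the translation-invariant kernel
# `Λ^{−D}Σ_k χ_k(x−y)∕(2n²ε_k + 1)²`, and ITS ENTRIES ARE HEAT INTEGRALS: `F₁²(x,y) = ∫₀^∞ u·e^{−u}·Π_i q^{Λ}_{2n²u}(x_i − y_i) du`

HONEST DEPENDENCY (page 1, mandatory): continuum YM on T⁴ ⇐ BetaPertH ∧ nine spine estimates (0/9 proved); BetaPertH ⇐ (D1) ∧ (D4) ∧
CAP+tail; G-an2-4 gates asym, D1 and NE2/3/4.  HONEST FRAMING (cell contract, verbatim): «discharging `BetaPertH` makes Bałaban's UV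
stability UNCONDITIONAL — a real constructive-QFT result; it is NOT the continuum limit and NOT the Clay problem.»  THIS MODULE is [folklore]
finite Fourier analysis + one Laplace transform (`∫₀^∞ u e^{−cu} du = c⁻²`, Mathlib's `Real.integral_rpow_mul_exp_neg_mul_Ioi`) over b05's typed
`B5Action121.LapS` (stencil form `LapS_mulVec`), the characters `TorusFourierProofs.torusChar` (eigenfunctions of the stencil:
`SliceFlatFreeKernel.sum_two_sub_char_eq_symb`) and FILE B-a `TorusHeatSemigroup.ofReal_prodHeat`.  It cites nothing as a hypothesis, mints no `Prop`,
has no `def`, 0 sorry.  Nothing here is specific to a gauge theory.  NOT hAB, NOT (T1′), NOT D1, NOT BetaPertH, NOT continuum, NOT Clay.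

ABSOLUTE RULE (cell charter, verbatim): «No internally-minted statement may enter as a cited fact. Every hypothesis is either kernel-proved in this
package or a verbatim quotation of a PUBLISHED theorem with page reference. The manuscript(s) under audit are NOT citable for their own disputed
steps — they are the thing under adjudication; programme-internal (2001/route/tribunal) claims are never citable.»

CONTENT.  §1 `LapS_add_one_mulVec_charKer` (the stencil-plus-one acts on a character kernel `x ↦ Λ^{−D}Σ_k χ_k(x−y)a_k` by multiplying the mode
coefficients by `2n²ε_k + 1`); §2 `sq_mul_charKer_eq_one` (with `a_k = (2n²ε_k+1)⁻²` two applications give the identity matrix — character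
orthogonality) and **`biResolvent_eq_charKer`**: `(Δ+1)⁻¹·(Δ+1)⁻¹ = of (x y ↦ Λ^{−D}Σ_k χ_k(x−y)(2n²ε_k+1)⁻²)`; §3 the Laplace transform per mode
(`integral_mul_exp_neg_mul_eq_inv_sq`) and **`biResolvent_apply_eq_integral`**: `((Δ+1)⁻¹·(Δ+1)⁻¹) x y = ↑(∫₀^∞ u e^{−u} Π_i q_{2n²u}((x − y)_i) du)`.
FILE B-b2 (`FreeBiResolventRowDiff`) differences this representation and sums rows with FILE B-a's `ℓ¹` bounds (the letters `φ₂ φ₃` of `GaugeFactorRowDiffSocket`).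
Unit `b2b-balaban-beta-d1-formalise-leaf-05` (gen 23), 2026-08-21; `LEAVES-FP.md` row «(T1′) SOCKET» (plan `HOME/…/leaf-05/g23/hAB-PLAN.md` v2).
-/

noncomputable section

open scoped BigOperators ComplexConjugate Matrix
open Finset MeasureTheory Set

namespace Summit.QuantumFields.BalabanUV.Beta.FP.FreeBiResolventKernel

open Literature.Probability.LatticeModels
open Literature.MathematicalPhysics.QuantumFieldTheory.Balaban1983to89
open Literature.MathematicalPhysics.QuantumFieldTheory.Balaban1983to89.B5Prop11Plancherel (Tor fine unitVec)
open Literature.MathematicalPhysics.QuantumFieldTheory.Balaban1983to89.B5Action121 (LapS LapS_mulVec)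
open Summit.QuantumFields.BalabanUV.T4Continuum.SliceFlatFreeKernel (symb sum_two_sub_char_eq_symb)
open Summit.QuantumFields.BalabanUV.Beta.FP.TorusHeatSemigroup (ofReal_prodHeat)

variable {D : ℕ} (Λ n : ℕ) [NeZero Λ] [NeZero n]

/-! ## §1 Characters are eigenvectors of b05's stencil Laplacian -/

/-- [folklore] **`(Δ + 1)` ON A CHARACTER KERNEL**: for mode coefficients `a : (ℤ∕Λ)^D → ℂ` and a base point `y`,
`(LapS + 1) *ᵥ (x ↦ Σ_k χ_k(x − y)·a_k) = x ↦ Σ_k χ_k(x − y)·((2n²ε_k + 1)·a_k)` (`ε_k = Σ_i(1 − cos p_{k,i})`, lattice factor `conj n · n = n²`). -/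
theorem LapS_add_one_mulVec_charKer (a : TorusSite D Λ → ℂ) (y : TorusSite D Λ) :
    (LapS (fun _ : Fin D => Λ) (n : ℂ) + 1) *ᵥ (fun x : TorusSite D Λ => ∑ k, torusChar k (x - y) * a k)
      = fun x => ∑ k, torusChar k (x - y) * (((symb (((n : ℝ) ^ 2)⁻¹) k * (n : ℝ) ^ 2 : ℝ) : ℂ) * a k) := by
  funext x
  rw [Matrix.add_mulVec, Matrix.one_mulVec, Pi.add_apply, LapS_mulVec]
  have hu : ∀ ν : Fin D, (unitVec (fun _ : Fin D => Λ) ν : TorusSite D Λ) = Pi.single ν 1 := fun ν => rfl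
  simp only [hu]
  -- per mode
  have hn : conj (n : ℂ) * (n : ℂ) = (((n : ℝ) ^ 2 : ℝ) : ℂ) := by
    rw [Complex.conj_natCast]; push_cast; ring
  have hmode : ∀ k : TorusSite D Λ,
      (∑ ν : Fin D, conj (n : ℂ) * (n : ℂ) * (2 * (torusChar k (x - y) * a k) - torusChar k (x + Pi.single ν 1 - y) * a k
          - torusChar k (x - Pi.single ν 1 - y) * a k)) + torusChar k (x - y) * a k
        = torusChar k (x - y) * (((symb (((n : ℝ) ^ 2)⁻¹) k * (n : ℝ) ^ 2 : ℝ) : ℂ) * a k) := by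
    intro k
    have e1 : ∀ ν : Fin D, torusChar k (x + Pi.single ν 1 - y) = torusChar k (x - y) * (ZMod.stdAddChar (k ν) : ℂ) := fun ν => by
      rw [show x + Pi.single ν 1 - y = (x - y) + Pi.single ν 1 by abel, torusChar_add_right, torusChar_single_eq_stdAddChar]
    have e2 : ∀ ν : Fin D, torusChar k (x - Pi.single ν 1 - y) = torusChar k (x - y) * conj (ZMod.stdAddChar (k ν) : ℂ) := fun ν => by
      rw [show x - Pi.single ν 1 - y = (x - y) - Pi.single ν 1 by abel, torusChar_sub_right, torusChar_single_eq_stdAddChar]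
    simp_rw [e1, e2, hn]
    have hfac : (∑ ν : Fin D, (((n : ℝ) ^ 2 : ℝ) : ℂ) * (2 * (torusChar k (x - y) * a k) - torusChar k (x - y) * (ZMod.stdAddChar (k ν) : ℂ) * a k
          - torusChar k (x - y) * conj (ZMod.stdAddChar (k ν) : ℂ) * a k)) + torusChar k (x - y) * a k
        = torusChar k (x - y) * a k * ((((n : ℝ) ^ 2 : ℝ) : ℂ) *
            ((∑ ν : Fin D, ((2 : ℂ) - (ZMod.stdAddChar (k ν) : ℂ) - conj (ZMod.stdAddChar (k ν) : ℂ))) + ((((n : ℝ) ^ 2)⁻¹ : ℝ) : ℂ))) := by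
      have hn0 : (((n : ℝ) ^ 2 : ℝ) : ℂ) ≠ 0 := by
        have : (0 : ℝ) < (n : ℝ) ^ 2 := by have := NeZero.pos n; positivity
        exact_mod_cast this.ne'
      rw [mul_add, mul_add, Finset.mul_sum, Finset.mul_sum, Complex.ofReal_inv, mul_inv_cancel₀ hn0, mul_one]
      congr 1
      exact Finset.sum_congr rfl fun ν _ => by ring
    rw [hfac, sum_two_sub_char_eq_symb]
    push_cast
    ring
  rw [← Finset.sum_congr rfl fun k _ => hmode k, Finset.sum_add_distrib, Finset.sum_comm]
  congr 1
  refine Finset.sum_congr rfl fun ν _ => ?_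
  simp only [Finset.mul_sum, ← Finset.sum_sub_distrib]

/-- [folklore] the same in MATRIX form: `(Δ + 1)·of(x y ↦ c·Σ_k χ_k(x−y)a_k) = of(x y ↦ c·Σ_k χ_k(x−y)(2n²ε_k+1)a_k)`. -/
theorem LapS_add_one_mul_charKer (c : ℂ) (a : TorusSite D Λ → ℂ) :
    (LapS (fun _ : Fin D => Λ) (n : ℂ) + 1) * Matrix.of (fun x y : TorusSite D Λ => c * ∑ k, torusChar k (x - y) * a k)
      = Matrix.of (fun x y : TorusSite D Λ => c * ∑ k, torusChar k (x - y) * (((symb (((n : ℝ) ^ 2)⁻¹) k * (n : ℝ) ^ 2 : ℝ) : ℂ) * a k)) := by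
  ext x y
  have h := congr_fun (LapS_add_one_mulVec_charKer Λ n (fun k => c * a k) y) x
  have e1 : (fun x : TorusSite D Λ => ∑ k, torusChar k (x - y) * (c * a k)) = fun x => c * ∑ k, torusChar k (x - y) * a k := by
    funext x'; rw [Finset.mul_sum]; exact Finset.sum_congr rfl fun k _ => by ring
  have e2 : (∑ k, torusChar k (x - y) * (((symb (((n : ℝ) ^ 2)⁻¹) k * (n : ℝ) ^ 2 : ℝ) : ℂ) * (c * a k)))
      = c * ∑ k, torusChar k (x - y) * (((symb (((n : ℝ) ^ 2)⁻¹) k * (n : ℝ) ^ 2 : ℝ) : ℂ) * a k) := by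
    rw [Finset.mul_sum]; exact Finset.sum_congr rfl fun k _ => by ring
  rw [e1, e2] at h
  rw [Matrix.mul_apply', Matrix.of_apply]
  exact h

/-! ## §2 The bi-resolvent is the character kernel with coefficients `(2n²ε_k + 1)⁻²` -/

omit [NeZero Λ] in
/-- [folklore] the coefficient `2n²ε_k + 1` is `≥ 1`, in particular nonzero. -/
theorem one_le_coeff (k : TorusSite D Λ) : 1 ≤ symb (((n : ℝ) ^ 2)⁻¹) k * (n : ℝ) ^ 2 := by
  have hn : (0 : ℝ) < (n : ℝ) ^ 2 := by have := NeZero.pos n; positivity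
  unfold symb
  rw [add_mul, inv_mul_cancel₀ hn.ne']
  have := dispersion_nonneg (latticeMomentum Λ k)
  nlinarith

/-- [folklore] **TWO APPLICATIONS OF `(Δ+1)` TO THE KERNEL WITH COEFFICIENTS `(2n²ε_k+1)⁻²` GIVE THE IDENTITY** (character orthogonality
`Σ_k χ_k(x − y) = Λ^D·[x = y]`). -/
theorem sq_mul_charKer_eq_one :
    (LapS (fun _ : Fin D => Λ) (n : ℂ) + 1) * ((LapS (fun _ : Fin D => Λ) (n : ℂ) + 1)
      * Matrix.of (fun x y : TorusSite D Λ => (((Λ : ℕ) : ℂ) ^ D)⁻¹ *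
          ∑ k, torusChar k (x - y) * (((symb (((n : ℝ) ^ 2)⁻¹) k * (n : ℝ) ^ 2)⁻¹ ^ 2 : ℝ) : ℂ))) = 1 := by
  rw [LapS_add_one_mul_charKer, LapS_add_one_mul_charKer]
  ext x y
  have hcoef : ∀ k : TorusSite D Λ, ((symb (((n : ℝ) ^ 2)⁻¹) k * (n : ℝ) ^ 2 : ℝ) : ℂ) *
      (((symb (((n : ℝ) ^ 2)⁻¹) k * (n : ℝ) ^ 2 : ℝ) : ℂ) * (((symb (((n : ℝ) ^ 2)⁻¹) k * (n : ℝ) ^ 2)⁻¹ ^ 2 : ℝ) : ℂ)) = 1 := by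
    intro k
    have h1 := one_le_coeff Λ n k
    generalize hc : symb (((n : ℝ) ^ 2)⁻¹) k * (n : ℝ) ^ 2 = c at h1 ⊢
    have hne : (c : ℂ) ≠ 0 := by exact_mod_cast (show c ≠ 0 by linarith)
    push_cast
    field_simp
  simp_rw [Matrix.of_apply, hcoef, mul_one]
  rw [sum_torusChar_left]
  have hΛ : (((Λ : ℕ) : ℂ) ^ D) ≠ 0 := natCast_pow_ne_zero
  by_cases hxy : x = y
  · subst hxy
    rw [if_pos (sub_self x), Matrix.one_apply_eq]
    exact inv_mul_cancel₀ hΛ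
  · rw [if_neg (sub_ne_zero.mpr hxy), Matrix.one_apply_ne hxy, mul_zero]

omit [NeZero n] in
/-- [folklore] `(Δ+1)⁻¹·(Δ+1)⁻¹ = ((Δ+1)(Δ+1))⁻¹`. -/
theorem inv_mul_inv_eq : (LapS (fun _ : Fin D => Λ) (n : ℂ) + 1)⁻¹ * (LapS (fun _ : Fin D => Λ) (n : ℂ) + 1)⁻¹
    = ((LapS (fun _ : Fin D => Λ) (n : ℂ) + 1) * (LapS (fun _ : Fin D => Λ) (n : ℂ) + 1))⁻¹ :=
  (Matrix.mul_inv_rev _ _).symm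

/-- [our bookkeeping] **THE FREE BI-RESOLVENT IS A CHARACTER KERNEL**: `(Δ+1)⁻¹·(Δ+1)⁻¹ = of(x y ↦ Λ^{−D}·Σ_k χ_k(x−y)·(2n²ε_k+1)⁻²)`. -/
theorem biResolvent_eq_charKer :
    (LapS (fun _ : Fin D => Λ) (n : ℂ) + 1)⁻¹ * (LapS (fun _ : Fin D => Λ) (n : ℂ) + 1)⁻¹
      = Matrix.of (fun x y : TorusSite D Λ => (((Λ : ℕ) : ℂ) ^ D)⁻¹ *
          ∑ k, torusChar k (x - y) * (((symb (((n : ℝ) ^ 2)⁻¹) k * (n : ℝ) ^ 2)⁻¹ ^ 2 : ℝ) : ℂ)) := by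
  rw [inv_mul_inv_eq]
  have h := sq_mul_charKer_eq_one (D := D) Λ n
  rw [← Matrix.mul_assoc] at h
  exact Matrix.inv_eq_right_inv h

/-! ## §3 The heat (Laplace) representation of the entries -/

/-- [folklore] `∫₀^∞ u·e^{−cu} du = c⁻²` for `c > 0` (`Γ(2) = 1`). -/
theorem integral_mul_exp_neg_mul_eq_inv_sq {c : ℝ} (hc : 0 < c) : ∫ u in Ioi (0 : ℝ), u * Real.exp (-(c * u)) = (c⁻¹) ^ 2 := by
  have h := Real.integral_rpow_mul_exp_neg_mul_Ioi (a := 2) (r := c) (by norm_num) hc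
  rw [show (2 : ℝ) - 1 = 1 by norm_num, Real.Gamma_two, mul_one, one_div, Real.rpow_two] at h
  rw [← h]
  refine setIntegral_congr_fun measurableSet_Ioi fun u _ => ?_
  rw [Real.rpow_one]

/-- [folklore] the Laplace integrand of one mode is integrable on `(0, ∞)`. -/
theorem integrableOn_mode (c : ℝ) (hc : 0 < c) (w : ℂ) :
    IntegrableOn (fun u : ℝ => w * (((u * Real.exp (-(c * u))) : ℝ) : ℂ)) (Ioi 0) := by
  have h0 : IntegrableOn (fun u : ℝ => u ^ (1 : ℝ) * Real.exp (-c * u ^ (1 : ℝ))) (Ioi 0) :=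
    integrableOn_rpow_mul_exp_neg_mul_rpow (by norm_num) le_rfl hc
  have h1 : IntegrableOn (fun u : ℝ => u * Real.exp (-(c * u))) (Ioi 0) := by
    refine h0.congr_fun (fun u _ => ?_) measurableSet_Ioi
    simp only [Real.rpow_one, neg_mul]
  exact (h1.ofReal).const_mul w

/-- [our bookkeeping] **THE ENTRIES OF THE FREE BI-RESOLVENT ARE HEAT INTEGRALS**:
`((Δ+1)⁻¹·(Δ+1)⁻¹) x y = ↑(∫₀^∞ u·e^{−u}·Π_i q^{Λ}_{2n²u}((x − y)_i) du)` — mode by mode `(2n²ε_k+1)⁻² = ∫₀^∞ u e^{−u(2n²ε_k+1)}du` and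
`Λ^{−D}Σ_kχ_k(z)e^{−2n²uε_k} = Π_i q_{2n²u}(z_i)` (FILE B-a `ofReal_prodHeat`). -/
theorem biResolvent_apply_eq_integral (x y : TorusSite D Λ) :
    ((LapS (fun _ : Fin D => Λ) (n : ℂ) + 1)⁻¹ * (LapS (fun _ : Fin D => Λ) (n : ℂ) + 1)⁻¹) x y
      = ((∫ u in Ioi (0 : ℝ), u * Real.exp (-u) * ∏ i, torusHeatKernel (2 * (n : ℝ) ^ 2 * u) ((x - y) i) : ℝ) : ℂ) := by
  rw [biResolvent_eq_charKer, Matrix.of_apply]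
  have hn : (0 : ℝ) < (n : ℝ) ^ 2 := by have := NeZero.pos n; positivity
  have hn' : (n : ℝ) ≠ 0 := by exact_mod_cast (NeZero.ne n)
  -- the Laplace transform, mode by mode
  have hcpos : ∀ k : TorusSite D Λ, 0 < symb (((n : ℝ) ^ 2)⁻¹) k * (n : ℝ) ^ 2 := fun k => lt_of_lt_of_le one_pos (one_le_coeff Λ n k)
  have hmode : ∀ k : TorusSite D Λ, torusChar k (x - y) * (((symb (((n : ℝ) ^ 2)⁻¹) k * (n : ℝ) ^ 2)⁻¹ ^ 2 : ℝ) : ℂ)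
      = ∫ u in Ioi (0 : ℝ), torusChar k (x - y) * (((u * Real.exp (-((symb (((n : ℝ) ^ 2)⁻¹) k * (n : ℝ) ^ 2) * u))) : ℝ) : ℂ) := by
    intro k
    rw [integral_const_mul, show (∫ u in Ioi (0 : ℝ), (((u * Real.exp (-((symb (((n : ℝ) ^ 2)⁻¹) k * (n : ℝ) ^ 2) * u))) : ℝ) : ℂ))
        = (((∫ u in Ioi (0 : ℝ), u * Real.exp (-((symb (((n : ℝ) ^ 2)⁻¹) k * (n : ℝ) ^ 2) * u))) : ℝ) : ℂ) from integral_ofReal,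
      integral_mul_exp_neg_mul_eq_inv_sq (hcpos k)]
  -- the exponent splits: `(2n²ε + 1)·u = u + (2n²u)·ε`
  have hexp : ∀ (k : TorusSite D Λ) (u : ℝ), Real.exp (-((symb (((n : ℝ) ^ 2)⁻¹) k * (n : ℝ) ^ 2) * u))
      = Real.exp (-u) * Real.exp (-((2 * (n : ℝ) ^ 2 * u) * dispersion (latticeMomentum Λ k))) := by
    intro k u
    rw [← Real.exp_add]
    congr 1
    unfold symb
    field_simp
    ring
  simp_rw [hmode]
  rw [← integral_finsetSum _ fun k _ => integrableOn_mode _ (hcpos k) _, ← integral_const_mul,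
    show (((∫ u in Ioi (0 : ℝ), u * Real.exp (-u) * ∏ i, torusHeatKernel (2 * (n : ℝ) ^ 2 * u) ((x - y) i)) : ℝ) : ℂ)
      = ∫ u in Ioi (0 : ℝ), (((u * Real.exp (-u) * ∏ i, torusHeatKernel (2 * (n : ℝ) ^ 2 * u) ((x - y) i)) : ℝ) : ℂ) from integral_ofReal.symm]
  refine setIntegral_congr_fun measurableSet_Ioi fun u _ => ?_
  have hprod := ofReal_prodHeat (Λ := Λ) (2 * (n : ℝ) ^ 2 * u) (x - y)
  simp only [hexp]
  push_cast at hprod ⊢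
  rw [hprod, Finset.mul_sum, Finset.mul_sum, Finset.mul_sum]
  refine Finset.sum_congr rfl fun k _ => ?_
  ring

end Summit.QuantumFields.BalabanUV.Beta.FP.FreeBiResolventKernel

end
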